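import Mathlib.Analysis.Calculus.InverseFunctionTheorem.ContDiff
import Literature.Geometry.Riemannian.MeanConvexCreaseCriterion
import Literature.Topology.FourManifolds.HomotopySpheres
import Literature.Topology.FourManifolds.Morse
import Literature.Topology.FourManifolds.ClosedBallProofs
import Literature.Topology.FourManifolds.DehnSurgeryTubularNbhdProofs

/-!
# Stub `stub_meanConvexReembeddingOfPresentation` of line `round-trace-continuity` for crux `OrigamiFoldExistence`
(item stmt-SmoothPoincare4-7844, route route-SmoothPoincare4-SymplecticOrigami)

**Lawson–Michelsohn re-embedding of a PRESENTED immersed fake ball.**  Let `S` be a homotopy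
4-sphere, `(e, F)` an immersed fake ball of `S` (`e : ℝ⁴ ↪ S` a smooth embedding, `F : S → ℝ⁴` a
local diffeomorphism at every point of `Δ_e := S ∖ e(B̊⁴)`), and let `g : S → ℝ` present `Δ_e` in
Morse form (`g` smooth, `{g ≤ 0} = Δ_e`, every critical point of `g` in `Δ_e` interior,
nondegenerate, of index `≤ 2`).  ASSUMING the Lawson–Michelsohn handle theorem — the antecedent of
the statement is, verbatim, the body of the Literature named fact
`Literature.Geometry.Riemannian.LawsonMichelsohn1984_meanConvexIsotopy_of_handles`
(Lawson–Michelsohn, *Embedding and surrounding with positive mean curvature*, Invent. Math. 77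
(1984), Thm. (3.1); vendored p86775) — there is a re-embedding `e'` of the ball, with the SAME
developing map `F`, whose crease `F ∘ e'|S³` is mean convex (the body of `CreaseMeanConvexAt`).

Proof (the wave-2 kernel reduction, packaged): apply the fact with `m := 3`, `M := S`, the
developing map `F`, `V := univ`; it returns an ambient diffeomorphism `φ` with `φ(Δ_e) ⊆ Δ_e` and
`H > 0` along `∂(φ Δ_e)` in the level-set idiom, read in flat charts `σ` of `F`.  Put `e' := φ ∘ e`:
* `fakeBall_transport`: `e'` is a smooth embedding (`Manifold.IsSmoothEmbedding.diffeomorph_comp`)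
  and `S ∖ e'(B̊⁴) = φ(Δ_e) ⊆ Δ_e`, so `F` is still a local diffeomorphism off `e'(B̊⁴)`;
* `fderiv_crease_bijective`: `D(F ∘ e')(u)` is bijective for `‖u‖ = 1` (immersion `e'`, local
  diffeomorphism `F` at `e' u ∈ Δ_{e'}`), so `Ψ := F ∘ e'` has a smooth local inverse `τ` at `u`
  (`ContDiffAt.localInverse`) and `σ := e' ∘ τ` is a flat chart of `F` at `e' u`;
* in that chart the fact's defining function is `g ∘ φ⁻¹ ∘ σ = ρ ∘ τ` with `ρ := g ∘ e`,
  `{ρ ≤ 0} = {1 ≤ ‖x‖}`, and the level-set clause translates into the crease inequality by the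
  landed criterion `Literature.Geometry.Riemannian.SphereCollar.creaseMeanConvex_of_levelSet` (p88080).
-/

noncomputable section

-- the prescribed namespace `Summit.<P>.<Sub>.…` duplicates `SmoothPoincare4` (P = Sub)
set_option linter.dupNamespace false

open scoped Manifold ContDiff Topology RealInnerProductSpace
open Set Function Filter

namespace Summit.SmoothPoincare4.SmoothPoincare4.Theorems.OrigamiFoldExistence.RoundTraceContinuity

/-! ### Transport of the fake-ball property along an ambient diffeomorphism preserving `Δ_e` -/

/-- **Transport of an immersed fake ball along an ambient diffeomorphism.**  If `e : ℝ⁴ ↪ S` is a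
smooth embedding, `F` is a local diffeomorphism off `e(B̊⁴)` and the diffeomorphism `φ` of `S` maps
`Δ_e = S ∖ e(B̊⁴)` into itself, then `e' := φ ∘ e` is a smooth embedding and `F` is a local
diffeomorphism off `e'(B̊⁴)` (indeed `S ∖ e'(B̊⁴) = φ(Δ_e) ⊆ Δ_e`).  Lee, *Introduction to smooth
manifolds* (2013), Ch. 4–5. [folklore] -/
theorem fakeBall_transport (S : Literature.Topology.FourManifolds.HomotopySphere 4)
    (e : EuclideanSpace ℝ (Fin 4) → S.carrier) (F : S.carrier → EuclideanSpace ℝ (Fin 4))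
    (he : Manifold.IsSmoothEmbedding (𝓡 4) (𝓡 4) ∞ e)
    (hF : ∀ x, x ∉ e '' Metric.ball (0 : EuclideanSpace ℝ (Fin 4)) 1 →
      IsLocalDiffeomorphAt (𝓡 4) (𝓡 4) ∞ F x)
    (φ : S.carrier ≃ₘ⟮𝓡 4, 𝓡 4⟯ S.carrier)
    (hφ : ∀ x, x ∉ e '' Metric.ball (0 : EuclideanSpace ℝ (Fin 4)) 1 →
      φ x ∉ e '' Metric.ball (0 : EuclideanSpace ℝ (Fin 4)) 1) :
    Manifold.IsSmoothEmbedding (𝓡 4) (𝓡 4) ∞ (φ ∘ e) ∧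
    ∀ x, x ∉ (φ ∘ e) '' Metric.ball (0 : EuclideanSpace ℝ (Fin 4)) 1 →
      IsLocalDiffeomorphAt (𝓡 4) (𝓡 4) ∞ F x := by
  have key : ∀ x, x ∉ (φ ∘ e) '' Metric.ball (0 : EuclideanSpace ℝ (Fin 4)) 1 ↔
      φ.symm x ∉ e '' Metric.ball (0 : EuclideanSpace ℝ (Fin 4)) 1 := by
    intro x
    rw [image_comp, not_iff_not]
    constructor
    · rintro ⟨y, hy, rfl⟩
      rwa [φ.symm_apply_apply]
    · intro hx
      exact ⟨φ.symm x, hx, φ.apply_symm_apply x⟩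
  refine ⟨he.diffeomorph_comp φ, fun x hx => ?_⟩
  have h1 := hφ _ ((key x).1 hx)
  rw [φ.apply_symm_apply] at h1
  exact hF x h1

/-! ### The crease differential of an immersed fake ball is bijective -/

/-- **The crease differential of an immersed fake ball is bijective**: for a smooth embedding
`e : ℝ⁴ ↪ S` and `F` a local diffeomorphism off `e(B̊⁴)`, `D(F ∘ e)(u)` is bijective at every
unit vector `u` (`De(u)` is injective between `4`-dimensional spaces, `DF(e u)` is invertible since
`e u ∉ e(B̊⁴)`). [folklore] -/
theorem fderiv_crease_bijective (S : Literature.Topology.FourManifolds.HomotopySphere 4)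
    (e : EuclideanSpace ℝ (Fin 4) → S.carrier) (F : S.carrier → EuclideanSpace ℝ (Fin 4))
    (he : Manifold.IsSmoothEmbedding (𝓡 4) (𝓡 4) ∞ e)
    (hF : ∀ x, x ∉ e '' Metric.ball (0 : EuclideanSpace ℝ (Fin 4)) 1 →
      IsLocalDiffeomorphAt (𝓡 4) (𝓡 4) ∞ F x)
    (u : EuclideanSpace ℝ (Fin 4)) (hu : ‖u‖ = 1) : Function.Bijective (fderiv ℝ (F ∘ e) u) := by
  have heu : e u ∉ e '' Metric.ball (0 : EuclideanSpace ℝ (Fin 4)) 1 := by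
    rintro ⟨y, hy, hye⟩
    have := he.isEmbedding.injective hye
    subst this
    rw [Metric.mem_ball, dist_zero_right, hu] at hy
    exact lt_irrefl _ hy
  have hloc := hF (e u) heu
  have hn : (∞ : WithTop ℕ∞) ≠ 0 := by simp
  have hinj : Injective (mfderiv (𝓡 4) (𝓡 4) e u) :=
    Literature.Topology.FourManifolds.mfderiv_injective_of_isImmersion he.isImmersion (by simp) u
  have hbij_e : Bijective (mfderiv (𝓡 4) (𝓡 4) e u) := by
    refine ⟨hinj, ?_⟩
    let A : EuclideanSpace ℝ (Fin 4) →ₗ[ℝ] EuclideanSpace ℝ (Fin 4) :=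
      (mfderiv (𝓡 4) (𝓡 4) e u).toLinearMap
    have hA : Injective A := hinj
    have hA' : Surjective A := (LinearMap.injective_iff_surjective (f := A)).1 hA
    exact hA'
  have hbij_F : Bijective (mfderiv (𝓡 4) (𝓡 4) F (e u)) :=
    (hloc.mfderivToContinuousLinearEquiv hn).bijective
  have hmd_e : MDifferentiableAt (𝓡 4) (𝓡 4) e u :=
    (he.contMDiff u).mdifferentiableAt (by simp)
  have hmd_F : MDifferentiableAt (𝓡 4) (𝓡 4) F (e u) := hloc.mdifferentiableAt hn
  have hcomp : mfderiv (𝓡 4) (𝓡 4) (F ∘ e) u =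
      (mfderiv (𝓡 4) (𝓡 4) F (e u)).comp (mfderiv (𝓡 4) (𝓡 4) e u) := mfderiv_comp u hmd_F hmd_e
  have hfd : fderiv ℝ (F ∘ e) u = mfderiv (𝓡 4) (𝓡 4) (F ∘ e) u := (mfderiv_eq_fderiv).symm
  rw [hfd, hcomp]
  exact hbij_F.comp hbij_e

/-! ### The stub: Lawson–Michelsohn fact ⇒ mean-convex re-embedding of a presented fake ball -/

/-- **Stub `stub_meanConvexReembeddingOfPresentation` (Lawson–Michelsohn re-embedding of a PRESENTED fake ball).** Under the
Lawson–Michelsohn handle theorem (antecedent = body of the Literature named fact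
`Literature.Geometry.Riemannian.LawsonMichelsohn1984_meanConvexIsotopy_of_handles`, p86775): an immersed fake ball `(e, F)` of a
homotopy 4-sphere whose `Δ_e` is presented in Morse form by `g` admits a re-embedding `e'` (same `F`) with mean-convex crease.
Lawson–Michelsohn 1984 Thm (3.1). [folklore] -/
theorem stub_meanConvexReembeddingOfPresentation :
    (∀ (m : ℕ) (M : Type) [TopologicalSpace M] [T2Space M] [SecondCountableTopology M] [ChartedSpace (EuclideanSpace ℝ (Fin (m + 1))) M] [IsManifold (𝓡 (m + 1)) ∞ M] (F : M → EuclideanSpace ℝ (Fin (m + 1))) (g : M → ℝ) (V : Set M), ContMDiff (𝓡 (m + 1)) 𝓘(ℝ, ℝ) ∞ g → IsCompact {x | g x ≤ 0} → (∀ x, g x ≤ 0 → IsLocalDiffeomorphAt (𝓡 (m + 1)) (𝓡 (m + 1)) ∞ F x) → (∀ x, g x ≤ 0 → Literature.Topology.FourManifolds.IsMCriticalPt (𝓡 (m + 1)) g x → g x < 0 ∧ (Literature.Topology.FourManifolds.mhessian (𝓡 (m + 1)) g x).Nondegenerate ∧ Literature.Topology.FourManifolds.morseIndex (𝓡 (m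 + 1)) g x + 1 ≤ m) → IsOpen V → {x | g x ≤ 0} ⊆ V → ∃ φ : M ≃ₘ⟮𝓡 (m + 1), 𝓡 (m + 1)⟯ M, (∀ x, x ∉ V → φ x = x) ∧ (∀ x, g x ≤ 0 → g (φ x) ≤ 0) ∧ ∀ y, g (φ.symm y) = 0 → ∀ σ : EuclideanSpace ℝ (Fin (m + 1)) → M, σ (F y) = y → ContMDiffAt (𝓡 (m + 1)) (𝓡 (m + 1)) ∞ σ (F y) → (∀ᶠ z in 𝓝 (F y), F (σ z) = z) → fderiv ℝ (fun z => g (φ.symm (σ z))) (F y) ≠ 0 ∧ ∀ v : Fin m → EuclideanSpace ℝ (Fin (m + 1)), Orthonormal ℝ v → (∀ i, fderiv ℝ (fun z => g (φ.symm (σ z))) (F y) (v i) = 0) → 0 < ∑ i, iteratedFDeriv ℝ 2 (fun z => g (φ.symm (σ z))) (F y) ![v i, v i]) → ∀ (S : Literature.Topology.FourManifolds.HomotopySphere 4) (e : EuclideanSpace ℝ (Fin 4) → S.carrier) (F : S.carrier → EuclideanSpace ℝ (Fin 4)) (g : S.carrier → ℝ), ContMDiff (𝓡 4) 𝓘(ℝ,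 ℝ) ∞ g → {x | g x ≤ 0} = {x | x ∉ e '' Metric.ball (0 : EuclideanSpace ℝ (Fin 4)) 1} → (∀ x, g x ≤ 0 → Literature.Topology.FourManifolds.IsMCriticalPt (𝓡 4) g x → g x < 0 ∧ (Literature.Topology.FourManifolds.mhessian (𝓡 4) g x).Nondegenerate ∧ Literature.Topology.FourManifolds.morseIndex (𝓡 4) g x + 1 ≤ 3) → (Manifold.IsSmoothEmbedding (𝓡 4) (𝓡 4) ∞ e ∧ ∀ x, x ∉ e '' Metric.ball (0 : EuclideanSpace ℝ (Fin 4)) 1 → IsLocalDiffeomorphAt (𝓡 4) (𝓡 4) ∞ F x) → ∃ e' : EuclideanSpace ℝ (Fin 4) → S.carrier, (Manifold.IsSmoothEmbedding (𝓡 4) (𝓡 4) ∞ e' ∧ ∀ x, x ∉ e' '' Metric.ball (0 : EuclideanSpace ℝ (Fin 4)) 1 → IsLocalDiffeomorphAt (𝓡 4) (𝓡 4) ∞ F x) ∧ ∀ u : EuclideanSpace ℝ (Fin 4), ‖u‖ = 1 → (∀ w : Fin 3 → EuclideanSpace ℝ (Fin 4), (∀ i, ⟪w i, u⟫ = 0)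 → Orthonormal ℝ (fun i => fderiv ℝ (F ∘ e') u (w i)) → ∑ i, ‖w i‖ ^ 2 < ∑ i, ⟪(fderiv ℝ (F ∘ e') u).inverse (fderiv ℝ (fun x => fderiv ℝ (F ∘ e') x (w i)) u (w i)), u⟫) := by
  intro hLM S e F g hg hgset hcrit heF
  obtain ⟨he, hF⟩ := heF
  have hmemD : ∀ x, g x ≤ 0 ↔ x ∉ e '' Metric.ball (0 : EuclideanSpace ℝ (Fin 4)) 1 := fun x => by
    have := congrArg (fun s : Set S.carrier => x ∈ s) hgset
    simpa using this
  have hFg : ∀ x, g x ≤ 0 → IsLocalDiffeomorphAt (𝓡 4) (𝓡 4) ∞ F x :=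
    fun x hx => hF x ((hmemD x).1 hx)
  have hDc : IsCompact {x | g x ≤ 0} :=
    (isClosed_le hg.continuous continuous_const).isCompact
  -- the Lawson–Michelsohn fact with `m := 3`, `M := S`, the developing map `F`, `V := univ`
  obtain ⟨φ, -, hφD, hφmc⟩ :=
    hLM 3 S.carrier F g univ hg hDc hFg hcrit isOpen_univ (subset_univ _)
  -- the re-embedded ball `e' := φ ∘ e`
  have hφΔ : ∀ x, x ∉ e '' Metric.ball (0 : EuclideanSpace ℝ (Fin 4)) 1 →
      φ x ∉ e '' Metric.ball (0 : EuclideanSpace ℝ (Fin 4)) 1 :=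
    fun x hx => (hmemD _).1 (hφD x ((hmemD x).2 hx))
  obtain ⟨he', hF'⟩ := fakeBall_transport S e F he hF φ hφΔ
  refine ⟨φ ∘ e, ⟨he', hF'⟩, ?_⟩
  intro u hu w hw hon
  -- the crease map `Ψ = F ∘ e'` near `u`
  set Ψ : EuclideanSpace ℝ (Fin 4) → EuclideanSpace ℝ (Fin 4) := F ∘ (φ ∘ e) with hΨdef
  have hu1 : u ∉ Metric.ball (0 : EuclideanSpace ℝ (Fin 4)) 1 := by
    rw [Metric.mem_ball, dist_zero_right, hu]; exact lt_irrefl _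
  have hyΔ : (φ ∘ e) u ∉ (φ ∘ e) '' Metric.ball (0 : EuclideanSpace ℝ (Fin 4)) 1 := by
    rintro ⟨y, hy, hye⟩
    exact hu1 (he'.isEmbedding.injective hye ▸ hy)
  have hΨm : ContMDiffAt (𝓡 4) (𝓡 4) ∞ Ψ u :=
    ((hF' _ hyΔ).contMDiffAt).comp u (he'.contMDiff u)
  have hΨc : ContDiffAt ℝ ∞ Ψ u := contMDiffAt_iff_contDiffAt.1 hΨm
  have hbij : Function.Bijective (fderiv ℝ Ψ u) :=
    fderiv_crease_bijective S (φ ∘ e) F he' hF' u hu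
  set Le : EuclideanSpace ℝ (Fin 4) ≃L[ℝ] EuclideanSpace ℝ (Fin 4) :=
    (LinearEquiv.ofBijective (fderiv ℝ Ψ u).toLinearMap hbij).toContinuousLinearEquiv with hLe
  have hLeL : (Le : EuclideanSpace ℝ (Fin 4) →L[ℝ] EuclideanSpace ℝ (Fin 4)) = fderiv ℝ Ψ u :=
    ContinuousLinearMap.ext fun x => rfl
  have hΨ' : HasFDerivAt Ψ (Le : EuclideanSpace ℝ (Fin 4) →L[ℝ] EuclideanSpace ℝ (Fin 4)) u := by
    rw [hLeL]; exact (hΨc.differentiableAt (by simp)).hasFDerivAt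
  have hn : (∞ : WithTop ℕ∞) ≠ 0 := by simp
  -- the local inverse `τ` of `Ψ` at `u`
  set τ : EuclideanSpace ℝ (Fin 4) → EuclideanSpace ℝ (Fin 4) := hΨc.localInverse hΨ' hn with hτdef
  have hs := hΨc.hasStrictFDerivAt' hΨ' hn
  have hτu : τ (Ψ u) = u := hΨc.localInverse_apply_image hΨ' hn
  have hτΨ : ∀ᶠ x in 𝓝 u, τ (Ψ x) = x := hs.eventually_left_inverse
  have hΨτ : ∀ᶠ z in 𝓝 (Ψ u), Ψ (τ z) = z := hs.eventually_right_inverse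
  have hτc : ContDiffAt ℝ ∞ τ (Ψ u) := hΨc.to_localInverse hΨ' hn
  -- the flat chart `σ = e' ∘ τ` of `F` at `y = e' u`
  set σ : EuclideanSpace ℝ (Fin 4) → S.carrier := (φ ∘ e) ∘ τ with hσdef
  have hy : F ((φ ∘ e) u) = Ψ u := rfl
  have hσ1 : σ (F ((φ ∘ e) u)) = (φ ∘ e) u := by
    show (φ ∘ e) (τ (Ψ u)) = _
    rw [hτu]
  have hσ2 : ContMDiffAt (𝓡 4) (𝓡 4) ∞ σ (F ((φ ∘ e) u)) := by
    rw [hy]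
    have hτm : ContMDiffAt (𝓡 4) (𝓡 4) ∞ τ (Ψ u) := contMDiffAt_iff_contDiffAt.2 hτc
    exact (he'.contMDiff (τ (Ψ u))).comp (Ψ u) hτm
  have hσ3 : ∀ᶠ z in 𝓝 (F ((φ ∘ e) u)), F (σ z) = z := by
    rw [hy]
    exact hΨτ.mono fun z hz => hz
  -- the pulled-back defining function `ρ = g ∘ e` of the exterior `{1 ≤ ‖x‖}`
  set ρ : EuclideanSpace ℝ (Fin 4) → ℝ := g ∘ e with hρdef
  have hρc : ContDiff ℝ ∞ ρ :=
    contMDiff_iff_contDiff.1 (hg.comp he.contMDiff)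
  have hρS : ∀ x, ρ x ≤ 0 ↔ 1 ≤ ‖x‖ := fun x => by
    show g (e x) ≤ 0 ↔ _
    rw [hmemD]
    constructor
    · intro hx
      by_contra hlt
      exact hx ⟨x, by rwa [Metric.mem_ball, dist_zero_right, ← not_le], rfl⟩
    · rintro hx ⟨y, hy, hye⟩
      have := he.isEmbedding.injective hye
      subst this
      rw [Metric.mem_ball, dist_zero_right] at hy
      exact (not_lt.2 hx) hy
  have hgy : g (φ.symm ((φ ∘ e) u)) = 0 := by
    show g (φ.symm (φ (e u))) = 0
    rw [φ.symm_apply_apply]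
    exact Literature.Geometry.Riemannian.SphereCollar.eq_zero_of_norm_eq_one (ρ := ρ)
      hρc.continuous hρS hu
  -- the named fact's mean-convexity clause in the chart `σ`
  obtain ⟨hreg, hmc⟩ := hφmc ((φ ∘ e) u) hgy σ hσ1 hσ2 hσ3
  have hGρ : (fun z => g (φ.symm (σ z))) = ρ ∘ τ := by
    funext z
    show g (φ.symm (φ (e (τ z)))) = g (e (τ z))
    rw [φ.symm_apply_apply]
  rw [hGρ, hy] at hreg hmc
  -- the crease translation (`SphereCollar.creaseMeanConvex_of_levelSet`, p88080)
  exact Literature.Geometry.Riemannian.SphereCollar.creaseMeanConvex_of_levelSet hu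
    (hΨc.of_le (by norm_cast)) (hτc.of_le (by norm_cast)) hτΨ (hρc.of_le (by norm_cast)) hρS
    hreg hmc w hw hon

end Summit.SmoothPoincare4.SmoothPoincare4.Theorems.OrigamiFoldExistence.RoundTraceContinuity

end
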